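import Literature.Analysis.FluidPDE.TypeIAncientMild

/-!
# The one-dimensional cell (Poincaré–Wirtinger, sup-norm) inequality — positive helper for the gap lines of
# crux `HelicalEndLiouville` (stmt-NavierStokesRegularity-14062), by the drefute seat (evidence for the prover).

For a `C²` curve `k : ℝ → F` with `k 1 = k 0` (one period) and `‖k''‖ ≤ D` on `[0,1]`:
`‖k 0 − ∫₀¹ k‖ ≤ D` (crude constant `1`; the sharp constant is ≈ 0.032, `¼` by the same argument with
`∫₀¹ s ds`, `∫₀¹|r−s| ds ≤ ½`). Proof by FTC twice, no "vanishes somewhere" step, so vector values are fine: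
`∫₀¹ k' = k 1 − k 0 = 0` gives `k' r = ∫₀¹ (k' r − k' s) ds`, `‖k' r − k' s‖ ≤ D|r − s| ≤ D`, hence `‖k'‖ ≤ D` on
`[0,1]`, hence `‖k s − k 0‖ ≤ D s ≤ D`, hence `‖k 0 − ∫₀¹ k‖ = ‖∫₀¹ (k 0 − k s) ds‖ ≤ D`.
This is the only new analytic lemma behind `stub_cellGaps` of line `vanishing-cell-reynolds`
(applied to `k s = h (x + s • L)` with `h = e^{σΔ}g` or `h = N_σ[f,g]`, `k'' s = D²h(x + sL)[L, L]`,
`‖k''‖ ≤ ‖iteratedFDeriv ℝ 2 h‖ ‖L‖²`).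
-/

noncomputable section
set_option linter.dupNamespace false
open MeasureTheory Set intervalIntegral

namespace Summit.NavierStokesRegularity.NavierStokesRegularity.Cruxes.HelicalEndLiouville.DRefute

variable {F : Type*} [NormedAddCommGroup F] [NormedSpace ℝ F] [CompleteSpace F]

/-- Mean-value bound for the first derivative of a periodic `C²` curve from a bound on the second:
if `k 1 = k 0` and `‖k''‖ ≤ D` on `[0,1]` then `‖k' r‖ ≤ D` on `[0,1]`. -/
theorem norm_deriv_le_of_periodic {k k' k'' : ℝ → F} (hk : ∀ r, HasDerivAt k (k' r) r)
    (hk' : ∀ r, HasDerivAt k' (k'' r) r) (hper : k 1 = k 0) {D : ℝ}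
    (hD : ∀ r ∈ Icc (0:ℝ) 1, ‖k'' r‖ ≤ D) {r : ℝ} (hr : r ∈ Icc (0:ℝ) 1) : ‖k' r‖ ≤ D := by
  have hk'c : Continuous k' := continuous_iff_continuousAt.2 fun x => (hk' x).continuousAt
  have hD0 : 0 ≤ D := (norm_nonneg _).trans (hD 0 ⟨le_rfl, zero_le_one⟩)
  -- the mean of `k'` over the period vanishes
  have hmean : ∫ s in (0:ℝ)..1, k' s = 0 := by
    rw [integral_eq_sub_of_hasDerivAt (fun x _ => hk x) (hk'c.intervalIntegrable 0 1), hper, sub_self]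
  -- Lipschitz bound on `k'` over the cell
  have hlip : ∀ s ∈ Icc (0:ℝ) 1, ‖k' r - k' s‖ ≤ D := by
    intro s hs
    have key := (convex_Icc (0:ℝ) 1).norm_image_sub_le_of_norm_hasDerivWithin_le
      (fun x _ => (hk' x).hasDerivWithinAt) hD hs hr
    refine key.trans ?_
    have hrs : ‖r - s‖ ≤ 1 := by
      rw [Real.norm_eq_abs, abs_le]
      constructor <;> linarith [hr.1, hr.2, hs.1, hs.2]
    calc D * ‖r - s‖ ≤ D * 1 := mul_le_mul_of_nonneg_left hrs hD0
      _ = D := mul_one D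
  -- `k' r = ∫₀¹ (k' r − k' s) ds`
  have hrepr : k' r = ∫ s in (0:ℝ)..1, (k' r - k' s) := by
    rw [integral_sub intervalIntegrable_const (hk'c.intervalIntegrable 0 1), hmean, sub_zero,
      intervalIntegral.integral_const]
    simp
  rw [hrepr]
  have := norm_integral_le_of_norm_le_const (a := (0:ℝ)) (b := 1) (C := D)
    (f := fun s => k' r - k' s) (fun s hs => hlip s ?_)
  · simpa using this
  · rw [uIoc_of_le zero_le_one] at hs
    exact ⟨hs.1.le, hs.2⟩

/-- **The cell inequality (sup-norm Poincaré–Wirtinger over one period, crude constant).**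
If `k 1 = k 0` and `‖k''‖ ≤ D` on `[0,1]` then `‖k 0 − ∫₀¹ k‖ ≤ D`. -/
theorem norm_sub_average_le_of_periodic {k k' k'' : ℝ → F} (hk : ∀ r, HasDerivAt k (k' r) r)
    (hk' : ∀ r, HasDerivAt k' (k'' r) r) (hper : k 1 = k 0) {D : ℝ}
    (hD : ∀ r ∈ Icc (0:ℝ) 1, ‖k'' r‖ ≤ D) : ‖k 0 - ∫ s in (0:ℝ)..1, k s‖ ≤ D := by
  have hkc : Continuous k := continuous_iff_continuousAt.2 fun x => (hk x).continuousAt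
  have hD0 : 0 ≤ D := (norm_nonneg _).trans (hD 0 ⟨le_rfl, zero_le_one⟩)
  have hd1 : ∀ r ∈ Icc (0:ℝ) 1, ‖k' r‖ ≤ D := fun r hr => norm_deriv_le_of_periodic hk hk' hper hD hr
  -- `‖k s − k 0‖ ≤ D` on the cell
  have hdev : ∀ s ∈ Icc (0:ℝ) 1, ‖k 0 - k s‖ ≤ D := by
    intro s hs
    have key := (convex_Icc (0:ℝ) 1).norm_image_sub_le_of_norm_hasDerivWithin_le
      (fun x _ => (hk x).hasDerivWithinAt) hd1 ⟨le_rfl, zero_le_one⟩ hs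
    rw [norm_sub_rev]
    refine key.trans ?_
    have hs1 : ‖s - 0‖ ≤ 1 := by
      rw [sub_zero, Real.norm_eq_abs, abs_le]; constructor <;> linarith [hs.1, hs.2]
    calc D * ‖s - 0‖ ≤ D * 1 := mul_le_mul_of_nonneg_left hs1 hD0
      _ = D := mul_one D
  have hrepr : k 0 - ∫ s in (0:ℝ)..1, k s = ∫ s in (0:ℝ)..1, (k 0 - k s) := by
    rw [integral_sub intervalIntegrable_const (hkc.intervalIntegrable 0 1), intervalIntegral.integral_const]
    simp
  rw [hrepr]
  have := norm_integral_le_of_norm_le_const (a := (0:ℝ)) (b := 1) (C := D)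
    (f := fun s => k 0 - k s) (fun s hs => hdev s ?_)
  · simpa using this
  · rw [uIoc_of_le zero_le_one] at hs
    exact ⟨hs.1.le, hs.2⟩

/-! ### Applied form: the oscillation of a `C²` field over one period of a line -/

section Line

variable {E : Type*} [NormedAddCommGroup E] [NormedSpace ℝ E]

/-- **Cell inequality along a line.** For `h : E → F` of class `C²` with `h (x + L) = h x` and
`‖D²h‖ ≤ B` everywhere, the deviation of `h x` from its average over the period segment
`{x + r • L : r ∈ [0,1]}` is at most `B ‖L‖²`:
`‖h x − ∫₀¹ h (x + r • L) dr‖ ≤ B ‖L‖²`. (With `h = e^{σΔ}g`, `B = A₂ σ⁻¹ M`, resp. `h = N_σ[f,g]`,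
`B = C₂ σ^{-3/2} M_f M_g`, this is the `‖L‖²`-branch of `stub_cellGaps`.) -/
theorem norm_sub_lineAverage_le {h : E → F} (hh : ContDiff ℝ 2 h) (x L : E) (hper : h (x + L) = h x)
    {B : ℝ} (hB : ∀ y, ‖iteratedFDeriv ℝ 2 h y‖ ≤ B) :
    ‖h x - ∫ r in (0:ℝ)..1, h (x + r • L)‖ ≤ B * ‖L‖ ^ 2 := by
  -- the path and its derivative
  set p : ℝ → E := fun s => x + s • L with hp
  have hpd : ∀ s, HasDerivAt p L s := fun s => by
    simpa [hp] using ((hasDerivAt_id s).smul_const L).const_add x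
  have hdiff : Differentiable ℝ h := hh.differentiable (by norm_num)
  have hdiff' : Differentiable ℝ (fderiv ℝ h) :=
    (hh.fderiv_right (m := 1) (by norm_num)).differentiable (by norm_num)
  -- k, k', k''
  set k : ℝ → F := fun s => h (p s) with hk
  set k' : ℝ → F := fun s => fderiv ℝ h (p s) L with hk'
  set k'' : ℝ → F := fun s => fderiv ℝ (fderiv ℝ h) (p s) L L with hk''
  have h1 : ∀ s, HasDerivAt k (k' s) s := fun s =>
    (hdiff (p s)).hasFDerivAt.comp_hasDerivAt s (hpd s)
  have h2 : ∀ s, HasDerivAt k' (k'' s) s := by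
    intro s
    have hg : HasDerivAt (fun r => fderiv ℝ h (p r)) (fderiv ℝ (fderiv ℝ h) (p s) L) s :=
      (hdiff' (p s)).hasFDerivAt.comp_hasDerivAt s (hpd s)
    have := hg.clm_apply (hasDerivAt_const s L)
    simpa [hk', hk''] using this
  have hper' : k 1 = k 0 := by simp [hk, hp, hper]
  have hD : ∀ r ∈ Icc (0:ℝ) 1, ‖k'' r‖ ≤ B * ‖L‖ ^ 2 := by
    intro r _
    have hn : ‖fderiv ℝ (fderiv ℝ h) (p r)‖ = ‖iteratedFDeriv ℝ 2 h (p r)‖ := by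
      rw [← norm_iteratedFDeriv_zero (𝕜 := ℝ) (f := fderiv ℝ (fderiv ℝ h)), norm_iteratedFDeriv_fderiv,
        norm_iteratedFDeriv_fderiv]
    calc ‖k'' r‖ ≤ ‖fderiv ℝ (fderiv ℝ h) (p r) L‖ * ‖L‖ := ContinuousLinearMap.le_opNorm _ _
      _ ≤ ‖fderiv ℝ (fderiv ℝ h) (p r)‖ * ‖L‖ * ‖L‖ :=
          mul_le_mul_of_nonneg_right (ContinuousLinearMap.le_opNorm _ _) (norm_nonneg _)
      _ ≤ B * ‖L‖ * ‖L‖ := by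
          rw [hn]
          exact mul_le_mul_of_nonneg_right (mul_le_mul_of_nonneg_right (hB _) (norm_nonneg _))
            (norm_nonneg _)
      _ = B * ‖L‖ ^ 2 := by ring
  have key := norm_sub_average_le_of_periodic h1 h2 hper' hD
  simpa [hk, hp] using key

end Line

end Summit.NavierStokesRegularity.NavierStokesRegularity.Cruxes.HelicalEndLiouville.DRefute
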